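import Summits.NavierStokesRegularity.NavierStokesRegularity.Theorems.PerpetualPumpThesisBesovDuhamelBoundParseval

/-!
# Stub `besovDuhamelBound` for `PerpetualPump.Thesis`, part IV: the Euler form in physical
# space — the `L^∞ × L^∞ × W^{1,1}` bound

Support file (part 4 of the stub `besovDuhamelBound` of line `SketchIdeator2`, crux
stmt-NavierStokesRegularity-1832). With the trilinear Parseval identity of part III, Tao's
Fourier-side Euler form `⟨B(F,G), H⟩ = -πi ∫∫ Λ(F̂(ξ₁), Ĝ(ξ₂), Ĥ(ξ₃))` (J. Amer. Math. Soc. 29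
(2016), (1.3)–(1.4)) on **divergence-free** `F, G` becomes `-∑_{j,l} ∫ (F_jG_l + F_lG_j) 𝓕⁻¹[ξ_jĤ_l]`
— the Fourier form of `(u·∇)v = ∇·(u⊗v)` for `∇·u = 0`, `FA.Λ_eq_of_cdot_eq_zero`,
`FA.integral_Λ_fourierFn_eq_sum` — whence the physical-space bound

  `|⟨B(F,G), H⟩| ≤ 2π ‖F‖_{L^∞} ‖G‖_{L^∞} ∑_{j,l} ‖𝓕⁻¹[ξ_j Ĥ_l]‖_{L¹}`

(`FA.enorm_eulerForm_le_of_schwartz`; `= ‖F‖_∞ ‖G‖_∞ ∑ ‖∂_jH_l‖_{L¹}`, cf. Tao p. 3: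
`⟨B(u,v),w⟩ = -½∫((u·∇)v + (v·∇)u)·w`). The derivative factors `ξ_jĤ_l` enter through Schwartz
functions `γ_{jl}` a.e. equal to them (honest Schwartz functions for the band-limited test fields
of the line).

## References

* T. Tao, J. Amer. Math. Soc. 29 (2016), 601–674, §1.1 (1.3)–(1.4) and p. 3.
-/

noncomputable section

open MeasureTheory Filter Topology FourierTransform Real Complex
open scoped SchwartzMap ENNReal NNReal ComplexConjugate RealInnerProductSpace FourierTransform

set_option linter.dupNamespace false

namespace Summit.NavierStokesRegularity.NavierStokesRegularity.Theorems.PerpetualPumpThesis.FA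

open Literature.Analysis.FunctionSpaces Literature.Analysis.FluidPDE
  Literature.Analysis.FluidPDE.Tao2016

/-! ### The Euler form in physical space -/

/-- **The Euler symbol on divergence-free slots**: if `ξ₁ · X₁ = 0` and `ξ₂ · X₂ = 0` then
`Λ_{ξ₁,ξ₂,ξ₃}(X₁,X₂,X₃) = -∑_{j,l} (X₁_j X₂_l + X₂_j X₁_l) (ξ₃)_j (X₃)_l`, `ξ₃ = -ξ₁-ξ₂`
(the Fourier form of `(u·∇)v = ∇·(u ⊗ v)` for `∇·u = 0`). -/
theorem Λ_eq_of_cdot_eq_zero (ξ₁ ξ₂ : EuclideanSpace ℝ (Fin 3)) (X₁ X₂ X₃ : EuclideanSpace ℂ (Fin 3))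
    (h1 : cdot (EuclideanSpace.complexify ξ₁) X₁ = 0) (h2 : cdot (EuclideanSpace.complexify ξ₂) X₂ = 0) :
    Λ ξ₁ ξ₂ X₁ X₂ X₃ = -∑ j, ∑ l, (X₁ j * X₂ l + X₂ j * X₁ l) *
      (EuclideanSpace.complexify (-ξ₁ - ξ₂) j * X₃ l) := by
  simp only [Λ, cdot, Fin.sum_univ_three, EuclideanSpace.complexify_apply, PiLp.sub_apply,
    PiLp.neg_apply, Complex.ofReal_sub, Complex.ofReal_neg] at h1 h2 ⊢
  linear_combination (-(X₂ 0 * X₃ 0 + X₂ 1 * X₃ 1 + X₂ 2 * X₃ 2)) * h1 -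
    (X₁ 0 * X₃ 0 + X₁ 1 * X₃ 1 + X₁ 2 * X₃ 2) * h2

/-- `|∫ F_j G_l c| ≤ ‖F‖_{L^∞} ‖G‖_{L^∞} ‖c‖_{L¹}` for fields `F, G` and a measurable scalar `c`. -/
theorem enorm_integral_mul_mul_le {F G : EuclideanSpace ℝ (Fin 3) → EuclideanSpace ℂ (Fin 3)}
    {c : EuclideanSpace ℝ (Fin 3) → ℂ} (hc : AEStronglyMeasurable c volume) (j l : Fin 3) :
    ‖∫ x, F x j * (G x l * c x)‖ₑ ≤
      eLpNorm F ∞ volume * eLpNorm G ∞ volume * eLpNorm c 1 volume := by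
  refine (enorm_integral_le_lintegral_enorm _).trans ?_
  have hF := enorm_ae_le_eLpNormEssSup F (volume : Measure (EuclideanSpace ℝ (Fin 3)))
  have hG := enorm_ae_le_eLpNormEssSup G (volume : Measure (EuclideanSpace ℝ (Fin 3)))
  calc ∫⁻ x, ‖F x j * (G x l * c x)‖ₑ
      ≤ ∫⁻ x, eLpNorm F ∞ volume * eLpNorm G ∞ volume * ‖c x‖ₑ := by
        refine lintegral_mono_ae ?_
        filter_upwards [hF, hG] with x hFx hGx
        rw [enorm_mul, enorm_mul, ← mul_assoc, eLpNorm_exponent_top, eLpNorm_exponent_top]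
        gcongr
        · exact (enorm_le_enorm_of_norm_le (PiLp.norm_apply_le (F x) j)).trans hFx
        · exact (enorm_le_enorm_of_norm_le (PiLp.norm_apply_le (G x) l)).trans hGx
    _ = eLpNorm F ∞ volume * eLpNorm G ∞ volume * eLpNorm c 1 volume := by
        rw [lintegral_const_mul'' _ hc.enorm, eLpNorm_one_eq_lintegral_enorm]

/-- One trilinear piece of (1.3) in physical space, bounded:
`|∫∫ F̂_j(ξ₁) Ĝ_l(ξ₂) γ(ξ₃)| ≤ ‖F‖_{L^∞} ‖G‖_{L^∞} ‖𝓕⁻¹γ‖_{L¹}`. -/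
theorem enorm_integral_prod_fourierFn_mul_le (F G : L2C) (hFi : Integrable (fourierFn F))
    (γ : 𝓢(EuclideanSpace ℝ (Fin 3), ℂ)) (j l : Fin 3) :
    ‖∫ p : EuclideanSpace ℝ (Fin 3) × EuclideanSpace ℝ (Fin 3),
        fourierFn F p.1 j * (fourierFn G p.2 l * γ (-p.1 - p.2)) ∂(volume.prod volume)‖ₑ ≤
      eLpNorm ((F : L2C) : EuclideanSpace ℝ (Fin 3) → EuclideanSpace ℂ (Fin 3)) ∞ volume *
        eLpNorm ((G : L2C) : EuclideanSpace ℝ (Fin 3) → EuclideanSpace ℂ (Fin 3)) ∞ volume *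
        eLpNorm (⇑(𝓕⁻ γ : 𝓢(EuclideanSpace ℝ (Fin 3), ℂ))) 1 volume := by
  rw [integral_prod_fourierFn_mul_eq F G hFi γ j l, ← SchwartzMap.fourierInv_coe]
  exact enorm_integral_mul_mul_le
    (𝓕⁻ γ : 𝓢(EuclideanSpace ℝ (Fin 3), ℂ)).continuous.aestronglyMeasurable j l

/-- **The integral of (1.3) for divergence-free slots as a sum of trilinear Fourier integrals**:
with `γ_{jl} = ξ_j Ĥ_l` a.e.,
`∫∫ Λ(F̂(ξ₁), Ĝ(ξ₂), Ĥ(ξ₃)) = -∑_{j,l} [∫∫ F̂_j Ĝ_l γ_{jl}(ξ₃) + ∫∫ F̂_l Ĝ_j γ_{jl}(ξ₃)]`. -/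
theorem integral_Λ_fourierFn_eq_sum {F G H : L2C} (hF : IsFourierDivFree F)
    (hG : IsFourierDivFree G) (hFi : Integrable (fourierFn F))
    (γ : Fin 3 → Fin 3 → 𝓢(EuclideanSpace ℝ (Fin 3), ℂ))
    (hγ : ∀ j l, (⇑(γ j l) : EuclideanSpace ℝ (Fin 3) → ℂ) =ᵐ[volume]
      fun ξ => EuclideanSpace.complexify ξ j * fourierFn H ξ l) :
    ∫ p : EuclideanSpace ℝ (Fin 3) × EuclideanSpace ℝ (Fin 3),
        Λ p.1 p.2 (fourierFn F p.1) (fourierFn G p.2) (fourierFn H (-p.1 - p.2)) ∂(volume.prod volume) =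
      -∑ j, ∑ l,
        ((∫ p : EuclideanSpace ℝ (Fin 3) × EuclideanSpace ℝ (Fin 3),
            fourierFn F p.1 j * (fourierFn G p.2 l * γ j l (-p.1 - p.2)) ∂(volume.prod volume)) +
          ∫ p : EuclideanSpace ℝ (Fin 3) × EuclideanSpace ℝ (Fin 3),
            fourierFn F p.1 l * (fourierFn G p.2 j * γ j l (-p.1 - p.2)) ∂(volume.prod volume)) := by
  set μ : Measure (EuclideanSpace ℝ (Fin 3)) := volume with hμ
  -- the integrand of (1.3), a.e. on `ℝ⁶`
  have hF' : ∀ᵐ p : EuclideanSpace ℝ (Fin 3) × EuclideanSpace ℝ (Fin 3) ∂(μ.prod μ),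
      cdot (EuclideanSpace.complexify p.1) (fourierFn F p.1) = 0 :=
    (Measure.quasiMeasurePreserving_fst (μ := μ) (ν := μ)).ae hF
  have hG' : ∀ᵐ p : EuclideanSpace ℝ (Fin 3) × EuclideanSpace ℝ (Fin 3) ∂(μ.prod μ),
      cdot (EuclideanSpace.complexify p.2) (fourierFn G p.2) = 0 :=
    (Measure.quasiMeasurePreserving_snd (μ := μ) (ν := μ)).ae hG
  have hγ' : ∀ j l, ∀ᵐ p : EuclideanSpace ℝ (Fin 3) × EuclideanSpace ℝ (Fin 3) ∂(μ.prod μ),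
      γ j l (-p.1 - p.2) = EuclideanSpace.complexify (-p.1 - p.2) j * fourierFn H (-p.1 - p.2) l :=
    fun j l => quasiMeasurePreserving_neg_fst_sub_snd.ae_eq (hγ j l)
  have hγ'' : ∀ᵐ p : EuclideanSpace ℝ (Fin 3) × EuclideanSpace ℝ (Fin 3) ∂(μ.prod μ), ∀ j l,
      γ j l (-p.1 - p.2) = EuclideanSpace.complexify (-p.1 - p.2) j * fourierFn H (-p.1 - p.2) l := by
    rw [ae_all_iff]; intro j; rw [ae_all_iff]; intro l; exact hγ' j l
  have hpt : ∀ᵐ p : EuclideanSpace ℝ (Fin 3) × EuclideanSpace ℝ (Fin 3) ∂(μ.prod μ),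
      Λ p.1 p.2 (fourierFn F p.1) (fourierFn G p.2) (fourierFn H (-p.1 - p.2)) =
        -∑ j, ∑ l, (fourierFn F p.1 j * (fourierFn G p.2 l * γ j l (-p.1 - p.2)) +
          fourierFn F p.1 l * (fourierFn G p.2 j * γ j l (-p.1 - p.2))) := by
    filter_upwards [hF', hG', hγ''] with p h1 h2 h3
    rw [Λ_eq_of_cdot_eq_zero _ _ _ _ _ h1 h2]
    congr 1
    refine Finset.sum_congr rfl fun j _ => Finset.sum_congr rfl fun l _ => ?_
    rw [h3 j l]
    ring
  -- integrability of every piece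
  have hI₁ : ∀ j l, Integrable (fun p : EuclideanSpace ℝ (Fin 3) × EuclideanSpace ℝ (Fin 3) =>
      fourierFn F p.1 j * (fourierFn G p.2 l * γ j l (-p.1 - p.2))) (μ.prod μ) :=
    fun j l => integrable_prod_fourierFn_mul F G hFi (γ j l) j l
  have hI₂ : ∀ j l, Integrable (fun p : EuclideanSpace ℝ (Fin 3) × EuclideanSpace ℝ (Fin 3) =>
      fourierFn F p.1 l * (fourierFn G p.2 j * γ j l (-p.1 - p.2))) (μ.prod μ) :=
    fun j l => integrable_prod_fourierFn_mul F G hFi (γ j l) l j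
  rw [integral_congr_ae hpt, integral_neg]
  congr 1
  rw [integral_finsetSum _ (fun j _ => ?_)]
  · refine Finset.sum_congr rfl fun j _ => ?_
    rw [integral_finsetSum _ (fun l _ => ?_)]
    · exact Finset.sum_congr rfl fun l _ => integral_add (hI₁ j l) (hI₂ j l)
    · exact (hI₁ j l).add (hI₂ j l)
  · exact integrable_finsetSum _ fun l _ => (hI₁ j l).add (hI₂ j l)

/-- **The Euler form in physical space: the `L^∞ × L^∞ × W^{1,1}` bound.** Let `F, G ∈ L²(ℝ³; ℂ³)`
be divergence free with `𝓕F ∈ L¹`, let `H ∈ L²` and let `γ_{jl}` be Schwartz functions with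
`γ_{jl}(ξ) = ξ_j Ĥ_l(ξ)` a.e. (so that `𝓕⁻¹γ_{jl} = ∂_j H_l / (2πi)`). Then
`|⟨B(F,G), H⟩| ≤ 2π ‖F‖_{L^∞} ‖G‖_{L^∞} ∑_{j,l} ‖𝓕⁻¹γ_{jl}‖_{L¹}` — i.e. `|⟨B(F,G),H⟩| ≤
‖F‖_∞ ‖G‖_∞ ∑ ‖∂_jH_l‖_{L¹}`, the physical-space form `⟨B(F,G),H⟩ = ½∫(F⊗G+G⊗F):∇H` of Tao's
(1.3) for `∇·F = ∇·G = 0`. Both sides may be infinite. -/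
theorem enorm_eulerForm_le_of_schwartz {F G H : L2C} (hF : IsFourierDivFree F)
    (hG : IsFourierDivFree G) (hFi : Integrable (fourierFn F))
    (γ : Fin 3 → Fin 3 → 𝓢(EuclideanSpace ℝ (Fin 3), ℂ))
    (hγ : ∀ j l, (⇑(γ j l) : EuclideanSpace ℝ (Fin 3) → ℂ) =ᵐ[volume]
      fun ξ => EuclideanSpace.complexify ξ j * fourierFn H ξ l) :
    ‖eulerForm F G H‖ₑ ≤
      ENNReal.ofReal (2 * π) *
        eLpNorm ((F : L2C) : EuclideanSpace ℝ (Fin 3) → EuclideanSpace ℂ (Fin 3)) ∞ volume *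
        eLpNorm ((G : L2C) : EuclideanSpace ℝ (Fin 3) → EuclideanSpace ℂ (Fin 3)) ∞ volume *
        ∑ j, ∑ l, eLpNorm (⇑(𝓕⁻ (γ j l) : 𝓢(EuclideanSpace ℝ (Fin 3), ℂ))) 1 volume := by
  set NF : ℝ≥0∞ := eLpNorm ((F : L2C) : EuclideanSpace ℝ (Fin 3) → EuclideanSpace ℂ (Fin 3)) ∞ volume
    with hNF
  set NG : ℝ≥0∞ := eLpNorm ((G : L2C) : EuclideanSpace ℝ (Fin 3) → EuclideanSpace ℂ (Fin 3)) ∞ volume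
    with hNG
  have hpi : ‖-(↑π * I)‖ₑ = ENNReal.ofReal π := by
    rw [enorm_neg, ← ofReal_norm, norm_mul, Complex.norm_real, Complex.norm_I, mul_one,
      Real.norm_of_nonneg Real.pi_pos.le]
  have hB : ∀ j l,
      ‖(∫ p : EuclideanSpace ℝ (Fin 3) × EuclideanSpace ℝ (Fin 3),
            fourierFn F p.1 j * (fourierFn G p.2 l * γ j l (-p.1 - p.2)) ∂(volume.prod volume)) +
          ∫ p : EuclideanSpace ℝ (Fin 3) × EuclideanSpace ℝ (Fin 3),
            fourierFn F p.1 l * (fourierFn G p.2 j * γ j l (-p.1 - p.2)) ∂(volume.prod volume)‖ₑ ≤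
        2 * (NF * NG * eLpNorm (⇑(𝓕⁻ (γ j l) : 𝓢(EuclideanSpace ℝ (Fin 3), ℂ))) 1 volume) := by
    intro j l
    rw [two_mul]
    exact (enorm_add_le _ _).trans (add_le_add
      (enorm_integral_prod_fourierFn_mul_le F G hFi (γ j l) j l)
      (enorm_integral_prod_fourierFn_mul_le F G hFi (γ j l) l j))
  unfold eulerForm
  rw [enorm_mul, hpi, Measure.volume_eq_prod, integral_Λ_fourierFn_eq_sum hF hG hFi γ hγ, enorm_neg]
  calc ENNReal.ofReal π * ‖∑ j, ∑ l,
        ((∫ p : EuclideanSpace ℝ (Fin 3) × EuclideanSpace ℝ (Fin 3),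
            fourierFn F p.1 j * (fourierFn G p.2 l * γ j l (-p.1 - p.2)) ∂(volume.prod volume)) +
          ∫ p : EuclideanSpace ℝ (Fin 3) × EuclideanSpace ℝ (Fin 3),
            fourierFn F p.1 l * (fourierFn G p.2 j * γ j l (-p.1 - p.2)) ∂(volume.prod volume))‖ₑ
      ≤ ENNReal.ofReal π * ∑ j, ∑ l,
          2 * (NF * NG * eLpNorm (⇑(𝓕⁻ (γ j l) : 𝓢(EuclideanSpace ℝ (Fin 3), ℂ))) 1 volume) := by
        gcongr
        refine (enorm_sum_le _ _).trans (Finset.sum_le_sum fun j _ => ?_)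
        exact (enorm_sum_le _ _).trans (Finset.sum_le_sum fun l _ => hB j l)
    _ = ENNReal.ofReal (2 * π) * NF * NG *
          ∑ j, ∑ l, eLpNorm (⇑(𝓕⁻ (γ j l) : 𝓢(EuclideanSpace ℝ (Fin 3), ℂ))) 1 volume := by
        rw [ENNReal.ofReal_mul zero_le_two, ENNReal.ofReal_ofNat]
        simp only [Finset.mul_sum]
        refine Finset.sum_congr rfl fun j _ => Finset.sum_congr rfl fun l _ => ?_
        ring

end Summit.NavierStokesRegularity.NavierStokesRegularity.Theorems.PerpetualPumpThesis.FA

namespace Summit.NavierStokesRegularity.NavierStokesRegularity.Theorems.PerpetualPumpThesis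

open Literature.Analysis.FluidPDE Literature.Analysis.FluidPDE.Tao2016
open Literature.Analysis.FunctionSpaces

/-- **Part Euler of stub `besovDuhamelBound` (registered sub-goal `stub_FA_Euler`)**: the
physical-space `L^∞ × L^∞ × W^{1,1}` bound for Tao's Euler trilinear form on divergence-free
slots, `|⟨B(F,G), H⟩| ≤ 2π ‖F‖_{L^∞} ‖G‖_{L^∞} ∑_{j,l} ‖𝓕⁻¹[ξ_j Ĥ_l]‖_{L¹}` (the derivative factors
entering through Schwartz functions a.e. equal to `ξ_j Ĥ_l`). -/
theorem stub_FA_Euler : ∀ (F G H : L2C), IsFourierDivFree F → IsFourierDivFree G → Integrable (fourierFn F) volume → ∀ γ : Fin 3 → Fin 3 → 𝓢(EuclideanSpace ℝ (Fin 3), ℂ), (∀ j l, (⇑(γ j l) : EuclideanSpace ℝ (Fin 3) → ℂ) =ᵐ[volume] fun ξ => EuclideanSpace.complexify ξ j * fourierFn H ξ l) → ‖eulerForm F G H‖ₑ ≤ ENNReal.ofReal (2 * Real.pi) * eLpNorm ((F : L2C) : EuclideanSpace ℝ (Fin 3) → EuclideanSpace ℂ (Fin 3)) ⊤ volume * eLpNorm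 ((G : L2C) : EuclideanSpace ℝ (Fin 3) → EuclideanSpace ℂ (Fin 3)) ⊤ volume * ∑ j, ∑ l, eLpNorm (⇑(FourierTransformInv.fourierInv (γ j l) : 𝓢(EuclideanSpace ℝ (Fin 3), ℂ))) 1 volume :=
  fun _ _ _ hF hG hFi γ hγ => FA.enorm_eulerForm_le_of_schwartz hF hG hFi γ hγ

end Summit.NavierStokesRegularity.NavierStokesRegularity.Theorems.PerpetualPumpThesis
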